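import Summits.QuantumFields.YangMills.Theorems.BalabanUVNodesN09HregSelOfThm1OfNumerics
import Summits.QuantumFields.YangMills.Theorems.BalabanUVNodesN09TransportPositiveOfLocalRoute
import Summits.QuantumFields.YangMills.Theorems.BalabanUVNodesN09FibreIntegralContinuousOfChartRegularity
import HarnessLib

/-!
# BalabanUVNodes ∕ N09 — THE CRIT-PARAMETRIC REGULARITY TOWER OF ROAD B over `TcanOfRecord`: for ANY letter `crit` and ANY (2.9)-shaped cut-off family `χ`, by induction on the step,
# `A_j` continuous on every `domAlt_j`, `hreg_j` and (F3)_j for all `j < K` — the bare, Sel and axial editions are instances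

Cell `pub-ymgap`, width seat `pub-ymgap-dag-n09-w2` generation 5 (HUMAN RULING D-0149; DAG node N09 = [Balaban1987RG1] §§2–5; INBOX CLAIM-5∕INTENT-9).
`--kind proof --supports stmt-QuantumFields-27364 --as helper` (K1⁹ `StabilityBRunRowsAtRecordR13SepCoPHV`; count-neutral; theorems only, 0 def ∕ 0 instance ∕ 0 notation ∕ 0 sorry).

WHY.  Road B's regularity tower exists in two editions — at the record's bare letter `critCfgOfRecord`∕`chiFixed29` (this seat's `…N09RegularityTowerOfLocalRoute`, p639613) and for K0c's
rooted offer `critCfgSelOfRecord`∕`chiFixed29Sel` (`…N09RegularityTowerSelOfThm1OfNumerics`).  dag-n09-w5 g6's located word (INBOX 14:29Z): the object print's (2.3)∕(2.5) p.265–266 centre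
the (2.9) window at is the AXIAL element of the critical orbit (`𝐆(V^{(k)}) = 0`), i.e. a THIRD letter `ax ∘ M^k ∘ Uk` (dag-n09-w2 FILE 5∕9), and dag-n09-w3 g6's crit-parametric files
(`…AnyCrit`) serve any letter.  This file composes them into the TOWER ONCE FOR EVERY LETTER: `crit : (k : ℕ) → GaugeField_{k+1} → GaugeField_k` and a cut-off family
`χ : (K : ℕ) → (ℕ → ℝ) → (k : ℕ) → Density` enter only through DISPLAYED per-step clauses — «`χ K g j` measurable and `{0,1}`-valued; `χ K g k = 1` exactly below the non-distinguished
thresholds `dist1 (crit k (Ū V) b)⁻¹·V(b)) < ε₁`» and «`crit k` on `domAlt_{k+1}`: in the fibre, Prop-2 small (`PlaqSmall δ`), continuous» — so road B is EDITION-INDEPENDENT: whichever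
letter the (2.3) re-point adopts, its N07 ∕ (H-U) ∕ (181) content is exactly the supplier of those clauses, and nothing below changes.

WHAT IS PROVED (theorems only; torus `K`, numerics `ν` (domains, `ε₀`), history `g`, letter `crit`, cut-off family `χ`, threshold `ε₁`, smallness `δ`, guard `α`).
§1 `cut_nonneg`, `cut_le_one`, `cut_eq_one_of_ne_zero` (bookkeeping of a `{0,1}`-valued cut-off), `betaInput_pos_at_crit` (the witness `crit k V` carries positive density: all its thresholds
   vanish by the fibre identity).
§2 ★★ `hregAnyCrit_pos_contA_step` (THE STEP, `k < K`: IH `ContinuousOn A_k domAlt_k` ⟹ (`hreg_k` ∧ `HasContTransportOn`) ∧ (F3)_k ∧ `ContinuousOn A_{k+1} domAlt_{k+1}`),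
   ★★★ `continuousOn_effActionHT_anyCrit_all` (THE TOWER `∀ j ≤ K`), ★★★ `hregAnyCrit_pos_all` (`∀ j < K`: `hreg_j` ∧ `HasContTransportOn` ∧ (F3)_j),
   ★★ `normConst_anyCrit_pos_and_eq_exp` (`𝐍_j > 0`, (0.19) `T_jρ_j = 𝐍_j·e^{A_{j+1}}` on `domAlt_{j+1}`; letter `0 < ν.ε₀`).
INSTANCE CHECK (kernel-verified in this seat's folder `work/dev_I9_withSelInstance.lean`, NOT landed — the gate's `dedup.landed` forbids restating p643077): at `crit k := critCfgSelOfRecord ν K k`,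
`χ := chiFixed29Sel ν ε₁`, `δ := 2εreg∕L²` the displayed clauses are K0c's `measurable_chiFixed29Sel` ∕ `chiFix29SelOfRecord_eq_zero_or_one` ∕ `_eq_one_iff`, `avg_critCfgSelOfRecord`, dag-n09-w3 g6's
`hcritSel_of_ukExists`, dag-n09-w1 g6's `hcritSel_domAlt_of_thm1_εbg_of_reg8`, and `hregAnyCrit_pos_all` reproduces `…N09RegularityTowerSelOfThm1OfNumerics.hregSel_pos_all_of_thm1_of_numerics` verbatim.

DISPLAYED (never asserted): the per-step `crit`∕`χ` clauses above (for the bare letter they are K0e's `chiFix29OfRecord_eq_one_iff`∕`_eq_zero_or_one`, `avg_critCfgOfRecord` + [B7] Prop 2 under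
`hsolν`, and the on-domain hcrit; for the Sel letter K0c's twins + dag-n09-w1 g6's selector continuity from [B11]'s two radii; for the axial letter its own suppliers — NOT claimed here);
NUMERICS `0 < ε₁`, `0 ≤ δ`, the guard `α ≤ 1∕24`, `α < δ_N`, `157α < L^{1−d}`, the rider's `hn1 hn2` and the margin `hαB` in `(ε₁, δ)` (dag-n09-w3 g6 FILE 4's shapes), STRICT (hord)
`δ + 4·max(ε₁, 10ℓε₁L^{d−1}) < ε₀`, `0 ≤ ε₀` resp. `0 < ε₀`, `((dL)²∕4)·ε₀ < δ_Fed`.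

HONEST FRAMING.  Count-neutral composition BY NAME; NOTHING of Bałaban's asserted; no letter is adopted or re-pointed here (that is def-T ∕ def-B's); `hreg`∕(F3)∕`contTOn` at the record rest
on the displayed clauses of whichever letter the record reads; N09 NOT discharged; conjunct 1 (Lemma 4) ∕ FLAG №7 untouched; K0⁷ ∕ K1⁹ ∕ K2⁹ ∕ K3⁸ NOT closed; counts unmoved (typed 28∕28 ·
discharged 5∕28); no summit statement is proved here; R4 = the conditional finite-𝕋⁴ rung `BalabanLadder.UV` only — NOT continuum ∕ ℝ⁴ ∕ OS; the Yang–Mills mass gap (Clay) is NOT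
proved by any of this.
-/

noncomputable section

open Filter Topology Set Function MeasureTheory

namespace Summit.QuantumFields.YangMills.BalabanUVNodes.N09RegularityTowerAnyCritOfLocalRoute

open Literature.MathematicalPhysics.QuantumFieldTheory.Balaban1983to89
open Literature.MathematicalPhysics.QuantumFieldTheory.Balaban1983to89.Node00
open Literature.MathematicalPhysics.QuantumFieldTheory.Balaban1983to89.T4Continuum (T4Family)
open Literature.MathematicalPhysics.QuantumFieldTheory.Balaban1983to89.BlockAveraging (Small Idx loopHol)
open Literature.MathematicalPhysics.QuantumFieldTheory.Balaban1983to89.BlockAveragingHaarAC (centralBond)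
open Literature.MathematicalPhysics.QuantumFieldTheory.Balaban1983to89.ExpMeanLog (expMeanLogSU deltaSU)
open Literature.MathematicalPhysics.QuantumFieldTheory.Balaban1983to89.FederbushMean (deltaFed)
open Literature.MathematicalPhysics.QuantumFieldTheory.Balaban1983to89.B12Eq019ActionBody (normConst_mul_exp_nextAction)
open Literature.MathematicalPhysics.QuantumFieldTheory.Balaban1983to89.B12ContinuousTransportInvarianceOn (isOpen_domAltOfRecord)
open Summit.QuantumFields.YangMills.BalabanUVNodes.N09HregSelOfThm1OfNumerics (localSupportSet_subset_domAlt_of_lt)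
open Summit.QuantumFields.YangMills.BalabanUVNodes.N09LocalSupportSetAtRecord (isClosed_loopLe_inter_plaqLe localSupportSet_subset_loopGuard)
open Summit.QuantumFields.YangMills.BalabanUVNodes.N09RegularOnOfLoopSmallThresholdsAnyCrit (regularOn_of_loopSmall_thresholds_local)
open Summit.QuantumFields.YangMills.BalabanUVNodes.N09LocalSupportSetAnyCrit (hρK_of_thresholds)
open Summit.QuantumFields.YangMills.BalabanUVNodes.N09DensityContinuousOffThresholdsAnyCrit (hρc_local_of_continuousOn_crit hρC_of_cut_le_one_of_continuousOn)
open Summit.QuantumFields.YangMills.BalabanUVNodes.N09BetaInputMeasurableOverTcan (measurable_betaInput_TcanOfRecord)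
open Summit.QuantumFields.YangMills.BalabanUVNodes.N09GaugeFixingTermContinuousOnAdmissible (continuousOn_gfOfRecord_domAlt)
open Summit.QuantumFields.YangMills.BalabanUVNodes.N09TransportPositiveOnDomainOfFibredChart (continuousOn_effActionHT_succ_of_subset_regSetOfRecord_of_pos)
open Summit.QuantumFields.YangMills.BalabanUVNodes.N09FibreIntegralContinuousOfChartRegularity (continuousOn_effActionHT_zero)
open Summit.QuantumFields.YangMills.BalabanUVNodes.N09TransportPositiveOfLocalRoute (TcanOfRecord_pos_of_localRoute_of_avg_eq)

variable {F : T4Family} {N : ℕ} [NeZero N]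

/-! ## §1 Bookkeeping of a `{0,1}`-valued cut-off; the witness carries positive density -/

section Cut

variable {K : ℕ} (g : ℕ → ℝ) (χ : (K : ℕ) → (ℕ → ℝ) → (k : ℕ) → Density (F.P K) k (SU N))

omit [NeZero N] in
/-- A `{0,1}`-valued cut-off is non-negative. [cite: Balaban1987RG1, (2.9) p.266 (bookkeeping)] -/
theorem cut_nonneg (hχ01 : ∀ j U, χ K g j U = 0 ∨ χ K g j U = 1) (j : ℕ) (U : GaugeField (F.P K) j (SU N)) : 0 ≤ χ K g j U := by
  rcases hχ01 j U with h | h <;> rw [h]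
  exact zero_le_one

omit [NeZero N] in
/-- A `{0,1}`-valued cut-off is at most one. [cite: Balaban1987RG1, (2.9) p.266 (bookkeeping)] -/
theorem cut_le_one (hχ01 : ∀ j U, χ K g j U = 0 ∨ χ K g j U = 1) (j : ℕ) (U : GaugeField (F.P K) j (SU N)) : χ K g j U ≤ 1 := by
  rcases hχ01 j U with h | h <;> rw [h]
  exact zero_le_one

/-- Where the β-input `ρ_k = χ_k·exp[−GF_k∕g_k² + A_k]` of a `{0,1}`-valued cut-off does not vanish, the cut-off equals one (any transport). [cite: Balaban1987RG1, (0.19) p.255 and (2.9) p.266] -/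
theorem cut_eq_one_of_ne_zero (T : Transport F N) (hχ01 : ∀ j U, χ K g j U = 0 ∨ χ K g j U = 1) (k : ℕ) (U : GaugeField (F.P K) k (SU N))
    (hρ : betaInputOfRecord F N T χ K g k U ≠ 0) : χ K g k U = 1 := by
  have e : betaInputOfRecord F N T χ K g k U = χ K g k U * Real.exp (-(1 / (g k) ^ 2) * gfOfRecord F N K k U + effActionHT F N T χ K g k U) := rfl
  rcases hχ01 k U with h | h
  · exact absurd (by rw [e, h, zero_mul]) hρ
  · exact h

/-- **THE WITNESS CARRIES POSITIVE DENSITY**: if `crit k V` lies in the fibre over `V` then every threshold of `crit k` at `crit k V` vanishes, so a cut-off equal to one below the thresholds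
(`0 < ε₁`) is one there and `ρ_k (crit k V) > 0` (any transport). [cite: Balaban1987RG1, (2.3) p.265, (2.9) p.266 and (0.19) p.255] -/
theorem betaInput_pos_at_crit (T : Transport F N) {k : ℕ} (crit : GaugeField (F.P K) (k + 1) (SU N) → GaugeField (F.P K) k (SU N)) {ε₁ : ℝ} (hε1 : 0 < ε₁)
    (hχ1 : ∀ V, (∀ b : PBond (F.P K) k, ¬ IsB0 b → dist1 ((crit ((avOfRecord F N K k).avg V) b)⁻¹ * V b) < ε₁) → χ K g k V = 1)
    {V : GaugeField (F.P K) (k + 1) (SU N)} (hfib : (avOfRecord F N K k).avg (crit V) = V) :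
    (∀ b : PBond (F.P K) k, dist1 ((crit ((avOfRecord F N K k).avg (crit V)) b)⁻¹ * crit V b) = 0) ∧ 0 < betaInputOfRecord F N T χ K g k (crit V) := by
  have h0 : ∀ b : PBond (F.P K) k, dist1 ((crit ((avOfRecord F N K k).avg (crit V)) b)⁻¹ * crit V b) = 0 := fun b => by
    rw [hfib, inv_mul_cancel, GaugeGroup.dist1_one]
  have hχ : χ K g k (crit V) = 1 := hχ1 _ fun b _ => by rw [h0 b]; exact hε1
  have e : betaInputOfRecord F N T χ K g k (crit V) =
      χ K g k (crit V) * Real.exp (-(1 / (g k) ^ 2) * gfOfRecord F N K k (crit V) + effActionHT F N T χ K g k (crit V)) := rfl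
  refine ⟨h0, ?_⟩
  rw [e, hχ, one_mul]
  exact Real.exp_pos _

end Cut

/-! ## §2 The step, the tower, `hreg_j` ∧ (F3)_j for all `j < K`, the normalisation constants -/

section Tower

variable (ν : Stage7Numerics) (K : ℕ) (g : ℕ → ℝ)
  (crit : (k : ℕ) → GaugeField (F.P K) (k + 1) (SU N) → GaugeField (F.P K) k (SU N))
  (χ : (K : ℕ) → (ℕ → ℝ) → (k : ℕ) → Density (F.P K) k (SU N)) {ε₁ δ α : ℝ}

/-- ★★ **THE STEP OF ROAD B FOR ANY LETTER** (`T = TcanOfRecord`, `k < K`): from the induction hypothesis `ContinuousOn A_k domAlt_k`, the displayed `crit`∕`χ` clauses of step `k` and numerics —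
**`hreg_k` ∧ `HasContTransportOn`** (dag-n09-w3 g6's `regularOn_of_loopSmall_thresholds_local (crit k)` on the local support set, fed `hρK_of_thresholds`, `hρc_local_of_continuousOn_crit`,
`hρC_of_cut_le_one_of_continuousOn`, `measurable_betaInput_TcanOfRecord χ`, K0's `integrable_betaInput_TcanOfRecord χ`), **(F3)_k** (this seat's `TcanOfRecord_pos_of_localRoute_of_avg_eq` at the
witness `crit k V`) and **`ContinuousOn A_{k+1} domAlt_{k+1}`** (dag-n09-w1 g5's corner). [cite: Balaban1987RG1, (0.19) p.255, p.259, (2.3) p.265, (2.9) p.266 and (2.10) p.267] -/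
theorem hregAnyCrit_pos_contA_step {k : ℕ} (hk : k < K) (hε1 : 0 < ε₁) (hδ : 0 ≤ δ)
    (hα24 : α ≤ 1 / 24) (hαδ : α < deltaSU (Fin N)) (hαL : 157 * α < (((F.P K).L : ℝ) ^ ((F.P K).d - 1))⁻¹)
    (hn1 : 1640 * (2 * (((((F.P K).d + 2) * (F.P K).L : ℕ) : ℝ) * ε₁) + ((((F.P K).d + 2) * (F.P K).L : ℕ) : ℝ) ^ 2 / 4 * δ) *
      (((F.P K).L : ℝ) ^ ((F.P K).d - 1)) ^ 2 ≤ 1)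
    (hn2 : 13 * (2 * (((((F.P K).d + 2) * (F.P K).L : ℕ) : ℝ) * ε₁) + ((((F.P K).d + 2) * (F.P K).L : ℕ) : ℝ) ^ 2 / 4 * δ) *
      ((F.P K).L : ℝ) ^ ((F.P K).d - 1) < deltaSU (Fin N))
    (hαB : ((((F.P K).d + 2) * (F.P K).L : ℕ) : ℝ) ^ 2 / 4 *
      (δ + 4 * max ε₁ (10 * (((((F.P K).d + 2) * (F.P K).L : ℕ) : ℝ) * ε₁) * ((F.P K).L : ℝ) ^ ((F.P K).d - 1))) < α)
    (hord : δ + 4 * max ε₁ (10 * (((((F.P K).d + 2) * (F.P K).L : ℕ) : ℝ) * ε₁) * ((F.P K).L : ℝ) ^ ((F.P K).d - 1)) < ν.ε₀)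
    (hε₀ : 0 ≤ ν.ε₀) (hGFnum : ((((F.P K).d * (F.P K).L : ℕ) : ℝ)) ^ 2 / 4 * ν.ε₀ < deltaFed (Fin N))
    -- the cut-off family (DISPLAYED): measurable, `{0,1}`-valued, `= 1` exactly below the thresholds of `crit k`
    (hχm : ∀ j, Measurable (χ K g j)) (hχ01 : ∀ j U, χ K g j U = 0 ∨ χ K g j U = 1)
    (hχ1 : ∀ V, χ K g k V = 1 ↔ ∀ b : PBond (F.P K) k, ¬ IsB0 b → dist1 ((crit k ((avOfRecord F N K k).avg V) b)⁻¹ * V b) < ε₁)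
    -- the letter at step `k` on the next domain (DISPLAYED): in the fibre, Prop-2 small, continuous
    (hfib : ∀ W ∈ domAltOfRecord F N ν K (k + 1), (avOfRecord F N K k).avg (crit k W) = W)
    (hcritδ : ∀ W ∈ domAltOfRecord F N ν K (k + 1), PlaqSmall δ (crit k W))
    (hcrit : ContinuousOn (crit k) (domAltOfRecord F N ν K (k + 1)))
    -- the tower's step-`k` output (induction hypothesis)
    (hA : ContinuousOn (effActionHT F N (TcanOfRecord F N) χ K g k) (domAltOfRecord F N ν K k)) :
    (domAltOfRecord F N ν K (k + 1) ⊆ regSetOfRecord F N K k (betaInputOfRecord F N (TcanOfRecord F N) χ K g k) ∧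
      HasContTransportOn F N K k (betaInputOfRecord F N (TcanOfRecord F N) χ K g k) (domAltOfRecord F N ν K (k + 1))) ∧
      (∀ V ∈ domAltOfRecord F N ν K (k + 1), 0 < TcanOfRecord F N K k (betaInputOfRecord F N (TcanOfRecord F N) χ K g k) V) ∧
      ContinuousOn (effActionHT F N (TcanOfRecord F N) χ K g (k + 1)) (domAltOfRecord F N ν K (k + 1)) := by
  have hk1 : k + 1 ≤ (F.P K).m + (F.P K).K := by simp only [T4Continuum.T4Family.P_K]; omega
  have hDk := isOpen_domAltOfRecord (F := F) (N := N) ν K k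
  have hDk1 := isOpen_domAltOfRecord (F := F) (N := N) ν K (k + 1)
  have hGF : ContinuousOn (gfOfRecord F N K k) (domAltOfRecord F N ν K k) := continuousOn_gfOfRecord_domAlt ν hk1 hε₀ hGFnum
  have hK₀D := localSupportSet_subset_domAlt_of_lt (F := F) (N := N) ν K k (α := α) hord
  have hK₀α := localSupportSet_subset_loopGuard (F := F) (N := N) K k (α := α)
    (B := δ + 4 * max ε₁ (10 * (((((F.P K).d + 2) * (F.P K).L : ℕ) : ℝ) * ε₁) * ((F.P K).L : ℝ) ^ ((F.P K).d - 1)))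
  -- the β-input and its elementary properties
  have hρe : ∀ U, betaInputOfRecord F N (TcanOfRecord F N) χ K g k U =
      χ K g k U * Real.exp (-(1 / (g k) ^ 2) * gfOfRecord F N K k U + effActionHT F N (TcanOfRecord F N) χ K g k U) := fun _ => rfl
  have hρm : Measurable (betaInputOfRecord F N (TcanOfRecord F N) χ K g k) := measurable_betaInput_TcanOfRecord χ K g hχm k
  have hρi : Integrable (betaInputOfRecord F N (TcanOfRecord F N) χ K g k) (fieldMeasure (F.P K) k (SU N)) :=
    integrable_betaInput_TcanOfRecord χ K g hχm (cut_nonneg g χ hχ01) (cut_le_one g χ hχ01) hk.le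
  have hρ0 : ∀ U, 0 ≤ betaInputOfRecord F N (TcanOfRecord F N) χ K g k U := fun U => by
    rw [hρe U]; exact mul_nonneg (cut_nonneg g χ hχ01 k U) (Real.exp_pos _).le
  have hχ1' : ∀ V, (∀ b : PBond (F.P K) k, ¬ IsB0 b → dist1 ((crit k ((avOfRecord F N K k).avg V) b)⁻¹ * V b) < ε₁) → χ K g k V = 1 :=
    fun V h => (hχ1 V).2 h
  have hχ0' : ∀ V, ¬ (∀ b : PBond (F.P K) k, ¬ IsB0 b → dist1 ((crit k ((avOfRecord F N K k).avg V) b)⁻¹ * V b) < ε₁) → χ K g k V = 0 :=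
    fun V h => (hχ01 k V).resolve_right fun h1 => h ((hχ1 V).1 h1)
  -- the three local clauses of dag-n09-w3 g6's door
  have hρC := hρC_of_cut_le_one_of_continuousOn (ρ := betaInputOfRecord F N (TcanOfRecord F N) χ K g k) (gk := g k) hρe (cut_le_one g χ hχ01 k)
    (isClosed_loopLe_inter_plaqLe _ _) hK₀D hGF hA
  have hρK := hρK_of_thresholds (crit k) hk hε1.le hδ hn1 hn2 hαB hfib hcritδ (ρ := betaInputOfRecord F N (TcanOfRecord F N) χ K g k)
    fun U hU b hb => (hχ1 U).1 (cut_eq_one_of_ne_zero g χ _ hχ01 k U hU) b hb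
  have hρc := hρc_local_of_continuousOn_crit (crit := crit k) (ρ := betaInputOfRecord F N (TcanOfRecord F N) χ K g k) (gk := g k) hρe hχ1' hχ0'
    hDk1 hDk hK₀D hαδ hK₀α hcrit hGF hA
  have hregpair := regularOn_of_loopSmall_thresholds_local (crit k) hk hα24 hαδ hαL hε1.ne' hρm hρi hρ0 hDk1 (isClosed_loopLe_inter_plaqLe _ _) hK₀α hρC hρK hρc
  -- (F3)_k at the witness `crit k V`
  have hpos : ∀ V ∈ domAltOfRecord F N ν K (k + 1), 0 < TcanOfRecord F N K k (betaInputOfRecord F N (TcanOfRecord F N) χ K g k) V := by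
    intro V hV
    have havg := hfib V hV
    obtain ⟨h0, hρpos⟩ := betaInput_pos_at_crit g χ (TcanOfRecord F N) (crit k) hε1 hχ1' havg
    have havgD : (avOfRecord F N K k).avg (crit k V) ∈ domAltOfRecord F N ν K (k + 1) := by rw [havg]; exact hV
    have hmem := interior_subset (hρK (crit k V) havgD hρpos.ne')
    exact TcanOfRecord_pos_of_localRoute_of_avg_eq hk hα24 hαδ hαL hρm hρ0 hρi havg (hK₀α _ hmem)
      (hρc _ hmem havgD fun b _ => by rw [h0 b]; exact hε1.ne) hρpos (hregpair.1 hV)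
  exact ⟨hregpair, hpos, continuousOn_effActionHT_succ_of_subset_regSetOfRecord_of_pos χ K g k hregpair.1 hpos⟩

/-- ★★★ **THE TOWER OF ROAD B FOR ANY LETTER: `A_j` IS CONTINUOUS ON `domAlt_j` FOR EVERY `j ≤ K`** (induction: base `continuousOn_effActionHT_zero`, step `hregAnyCrit_pos_contA_step`).
[cite: Balaban1987RG1, (0.17)–(0.19) p.255, p.259, (2.9) p.266 and (2.10) p.267] -/
theorem continuousOn_effActionHT_anyCrit_all (hε1 : 0 < ε₁) (hδ : 0 ≤ δ)
    (hα24 : α ≤ 1 / 24) (hαδ : α < deltaSU (Fin N)) (hαL : 157 * α < (((F.P K).L : ℝ) ^ ((F.P K).d - 1))⁻¹)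
    (hn1 : 1640 * (2 * (((((F.P K).d + 2) * (F.P K).L : ℕ) : ℝ) * ε₁) + ((((F.P K).d + 2) * (F.P K).L : ℕ) : ℝ) ^ 2 / 4 * δ) *
      (((F.P K).L : ℝ) ^ ((F.P K).d - 1)) ^ 2 ≤ 1)
    (hn2 : 13 * (2 * (((((F.P K).d + 2) * (F.P K).L : ℕ) : ℝ) * ε₁) + ((((F.P K).d + 2) * (F.P K).L : ℕ) : ℝ) ^ 2 / 4 * δ) *
      ((F.P K).L : ℝ) ^ ((F.P K).d - 1) < deltaSU (Fin N))
    (hαB : ((((F.P K).d + 2) * (F.P K).L : ℕ) : ℝ) ^ 2 / 4 *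
      (δ + 4 * max ε₁ (10 * (((((F.P K).d + 2) * (F.P K).L : ℕ) : ℝ) * ε₁) * ((F.P K).L : ℝ) ^ ((F.P K).d - 1))) < α)
    (hord : δ + 4 * max ε₁ (10 * (((((F.P K).d + 2) * (F.P K).L : ℕ) : ℝ) * ε₁) * ((F.P K).L : ℝ) ^ ((F.P K).d - 1)) < ν.ε₀)
    (hε₀ : 0 ≤ ν.ε₀) (hGFnum : ((((F.P K).d * (F.P K).L : ℕ) : ℝ)) ^ 2 / 4 * ν.ε₀ < deltaFed (Fin N))
    (hχm : ∀ j, Measurable (χ K g j)) (hχ01 : ∀ j U, χ K g j U = 0 ∨ χ K g j U = 1)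
    (hχ1 : ∀ j < K, ∀ V, χ K g j V = 1 ↔ ∀ b : PBond (F.P K) j, ¬ IsB0 b → dist1 ((crit j ((avOfRecord F N K j).avg V) b)⁻¹ * V b) < ε₁)
    (hfib : ∀ j < K, ∀ W ∈ domAltOfRecord F N ν K (j + 1), (avOfRecord F N K j).avg (crit j W) = W)
    (hcritδ : ∀ j < K, ∀ W ∈ domAltOfRecord F N ν K (j + 1), PlaqSmall δ (crit j W))
    (hcrit : ∀ j < K, ContinuousOn (crit j) (domAltOfRecord F N ν K (j + 1))) :
    ∀ j, j ≤ K → ContinuousOn (effActionHT F N (TcanOfRecord F N) χ K g j) (domAltOfRecord F N ν K j)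
  | 0, _ => continuousOn_effActionHT_zero _ _ K g _
  | j + 1, hj => by
    have hjK : j < K := Nat.lt_of_succ_le hj
    have ih := continuousOn_effActionHT_anyCrit_all hε1 hδ hα24 hαδ hαL hn1 hn2 hαB hord hε₀ hGFnum hχm hχ01 hχ1 hfib hcritδ hcrit j hjK.le
    exact (hregAnyCrit_pos_contA_step ν K g crit χ hjK hε1 hδ hα24 hαδ hαL hn1 hn2 hαB hord hε₀ hGFnum hχm hχ01 (hχ1 j hjK) (hfib j hjK)
      (hcritδ j hjK) (hcrit j hjK) ih).2.2

/-- ★★★ **… HENCE, FOR EVERY `j < K` AND ANY LETTER: `hreg_j`, the on-domain proviso `HasContTransportOn … ρ_j domAlt_{j+1}`, AND (F3)_j** — road B edition-independent.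
[cite: Balaban1987RG1, p.259, (0.13) p.254, (0.19) p.255 and (2.10) p.267] -/
theorem hregAnyCrit_pos_all (hε1 : 0 < ε₁) (hδ : 0 ≤ δ)
    (hα24 : α ≤ 1 / 24) (hαδ : α < deltaSU (Fin N)) (hαL : 157 * α < (((F.P K).L : ℝ) ^ ((F.P K).d - 1))⁻¹)
    (hn1 : 1640 * (2 * (((((F.P K).d + 2) * (F.P K).L : ℕ) : ℝ) * ε₁) + ((((F.P K).d + 2) * (F.P K).L : ℕ) : ℝ) ^ 2 / 4 * δ) *
      (((F.P K).L : ℝ) ^ ((F.P K).d - 1)) ^ 2 ≤ 1)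
    (hn2 : 13 * (2 * (((((F.P K).d + 2) * (F.P K).L : ℕ) : ℝ) * ε₁) + ((((F.P K).d + 2) * (F.P K).L : ℕ) : ℝ) ^ 2 / 4 * δ) *
      ((F.P K).L : ℝ) ^ ((F.P K).d - 1) < deltaSU (Fin N))
    (hαB : ((((F.P K).d + 2) * (F.P K).L : ℕ) : ℝ) ^ 2 / 4 *
      (δ + 4 * max ε₁ (10 * (((((F.P K).d + 2) * (F.P K).L : ℕ) : ℝ) * ε₁) * ((F.P K).L : ℝ) ^ ((F.P K).d - 1))) < α)
    (hord : δ + 4 * max ε₁ (10 * (((((F.P K).d + 2) * (F.P K).L : ℕ) : ℝ) * ε₁) * ((F.P K).L : ℝ) ^ ((F.P K).d - 1)) < ν.ε₀)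
    (hε₀ : 0 ≤ ν.ε₀) (hGFnum : ((((F.P K).d * (F.P K).L : ℕ) : ℝ)) ^ 2 / 4 * ν.ε₀ < deltaFed (Fin N))
    (hχm : ∀ j, Measurable (χ K g j)) (hχ01 : ∀ j U, χ K g j U = 0 ∨ χ K g j U = 1)
    (hχ1 : ∀ j < K, ∀ V, χ K g j V = 1 ↔ ∀ b : PBond (F.P K) j, ¬ IsB0 b → dist1 ((crit j ((avOfRecord F N K j).avg V) b)⁻¹ * V b) < ε₁)
    (hfib : ∀ j < K, ∀ W ∈ domAltOfRecord F N ν K (j + 1), (avOfRecord F N K j).avg (crit j W) = W)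
    (hcritδ : ∀ j < K, ∀ W ∈ domAltOfRecord F N ν K (j + 1), PlaqSmall δ (crit j W))
    (hcrit : ∀ j < K, ContinuousOn (crit j) (domAltOfRecord F N ν K (j + 1))) :
    ∀ j < K, (domAltOfRecord F N ν K (j + 1) ⊆ regSetOfRecord F N K j (betaInputOfRecord F N (TcanOfRecord F N) χ K g j) ∧
        HasContTransportOn F N K j (betaInputOfRecord F N (TcanOfRecord F N) χ K g j) (domAltOfRecord F N ν K (j + 1))) ∧
      ∀ V ∈ domAltOfRecord F N ν K (j + 1), 0 < TcanOfRecord F N K j (betaInputOfRecord F N (TcanOfRecord F N) χ K g j) V := by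
  intro j hj
  have h := hregAnyCrit_pos_contA_step ν K g crit χ hj hε1 hδ hα24 hαδ hαL hn1 hn2 hαB hord hε₀ hGFnum hχm hχ01 (hχ1 j hj) (hfib j hj) (hcritδ j hj)
    (hcrit j hj) (continuousOn_effActionHT_anyCrit_all ν K g crit χ hε1 hδ hα24 hαδ hαL hn1 hn2 hαB hord hε₀ hGFnum hχm hχ01 hχ1 hfib hcritδ hcrit j hj.le)
  exact ⟨h.1, h.2.1⟩

/-- ★★ **EVERY NORMALISATION CONSTANT `𝐍_j = T_jρ_j(1)` IS POSITIVE and (0.19) `T_jρ_j = 𝐍_j·e^{A_{j+1}}` HOLDS ON EVERY DOMAIN, FOR ANY LETTER** (`1 ∈ domAlt_{j+1}` when `0 < ν.ε₀`).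
[cite: Balaban1987RG1, (0.19) p.255–256 and p.259] -/
theorem normConst_anyCrit_pos_and_eq_exp (hε₀' : 0 < ν.ε₀) (hε1 : 0 < ε₁) (hδ : 0 ≤ δ)
    (hα24 : α ≤ 1 / 24) (hαδ : α < deltaSU (Fin N)) (hαL : 157 * α < (((F.P K).L : ℝ) ^ ((F.P K).d - 1))⁻¹)
    (hn1 : 1640 * (2 * (((((F.P K).d + 2) * (F.P K).L : ℕ) : ℝ) * ε₁) + ((((F.P K).d + 2) * (F.P K).L : ℕ) : ℝ) ^ 2 / 4 * δ) *
      (((F.P K).L : ℝ) ^ ((F.P K).d - 1)) ^ 2 ≤ 1)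
    (hn2 : 13 * (2 * (((((F.P K).d + 2) * (F.P K).L : ℕ) : ℝ) * ε₁) + ((((F.P K).d + 2) * (F.P K).L : ℕ) : ℝ) ^ 2 / 4 * δ) *
      ((F.P K).L : ℝ) ^ ((F.P K).d - 1) < deltaSU (Fin N))
    (hαB : ((((F.P K).d + 2) * (F.P K).L : ℕ) : ℝ) ^ 2 / 4 *
      (δ + 4 * max ε₁ (10 * (((((F.P K).d + 2) * (F.P K).L : ℕ) : ℝ) * ε₁) * ((F.P K).L : ℝ) ^ ((F.P K).d - 1))) < α)
    (hord : δ + 4 * max ε₁ (10 * (((((F.P K).d + 2) * (F.P K).L : ℕ) : ℝ) * ε₁) * ((F.P K).L : ℝ) ^ ((F.P K).d - 1)) < ν.ε₀)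
    (hGFnum : ((((F.P K).d * (F.P K).L : ℕ) : ℝ)) ^ 2 / 4 * ν.ε₀ < deltaFed (Fin N))
    (hχm : ∀ j, Measurable (χ K g j)) (hχ01 : ∀ j U, χ K g j U = 0 ∨ χ K g j U = 1)
    (hχ1 : ∀ j < K, ∀ V, χ K g j V = 1 ↔ ∀ b : PBond (F.P K) j, ¬ IsB0 b → dist1 ((crit j ((avOfRecord F N K j).avg V) b)⁻¹ * V b) < ε₁)
    (hfib : ∀ j < K, ∀ W ∈ domAltOfRecord F N ν K (j + 1), (avOfRecord F N K j).avg (crit j W) = W)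
    (hcritδ : ∀ j < K, ∀ W ∈ domAltOfRecord F N ν K (j + 1), PlaqSmall δ (crit j W))
    (hcrit : ∀ j < K, ContinuousOn (crit j) (domAltOfRecord F N ν K (j + 1))) :
    ∀ j < K, 0 < normConstHT F N (TcanOfRecord F N) χ K g j ∧
      ∀ V ∈ domAltOfRecord F N ν K (j + 1),
        TcanOfRecord F N K j (betaInputOfRecord F N (TcanOfRecord F N) χ K g j) V
          = normConstHT F N (TcanOfRecord F N) χ K g j * Real.exp (effActionHT F N (TcanOfRecord F N) χ K g (j + 1) V) := by
  intro j hj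
  have hpos := (hregAnyCrit_pos_all ν K g crit χ hε1 hδ hα24 hαδ hαL hn1 hn2 hαB hord hε₀'.le hGFnum hχm hχ01 hχ1 hfib hcritδ hcrit j hj).2
  have hN : 0 < normConstHT F N (TcanOfRecord F N) χ K g j := hpos 1 (one_mem_domAltOfRecord ν hε₀' K (j + 1))
  refine ⟨hN, fun V hV => ?_⟩
  rw [effActionHT_succ]
  exact (normConst_mul_exp_nextAction _ _ _ _ _ hN (hpos V hV)).symm

end Tower


end Summit.QuantumFields.YangMills.BalabanUVNodes.N09RegularityTowerAnyCritOfLocalRoute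

end
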